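import Summits.QuantumFields.BalabanUV.Beta.FP.PerfectGaugeDefectBottomLimit
import Summits.QuantumFields.BalabanUV.Beta.FP.NestedDressingKernel

/-!
# `BalabanUV.Beta.FP.PerfectGaugeDefectBottomDressed` — road «FP» for binder row D1, W-ORACLE-K row **SPLIT, part (i-b) in the OWNER's Π-currency** (owner d1-p3 gen 15,
# memo `N2B-DESIGN.md` v3.1 §11 (11b); journal [D1P3-G15-WORACLEK] ∕ GO [D1P3-G15-WORDS2]): **THE FIELD–FIELD ENTRY OF THE Π-CO-DRESSING `Π̂·E·Π̂ᵀ` OF ANY KERNEL BY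
# leaf-06's NESTED PROJECTOR KERNEL `piKSymNest ρ Lc M` IS A FINITE DOUBLE-WINDOW SUM, AND `[Π̂·E♭_m·Π̂ᵀ]_ff = 0` AS SOON AS `[Π̂·E_j·Π̂ᵀ]_ff = 0` AT (EVENTUALLY)
# EVERY FINITE `j`** (`d + 1 = 4`, `Lc ≥ 2`, `m ≥ 1`; `E♭_m` the perfect bottom defect, `E_j` the bare finite-`j` bottom defects — both as KERNELS)

HONEST DEPENDENCY (page 1, mandatory): continuum YM on T⁴ ⇐ BetaPertH ∧ nine spine estimates (0/9 proved); BetaPertH ⇐ (D1) ∧ (D4) ∧ CAP+tail;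
G-an2-4 gates asym, D1 and NE2/3/4.  HONEST FRAMING (cell contract, verbatim): «discharging `BetaPertH` makes Bałaban's UV stability UNCONDITIONAL —
a real constructive-QFT result; it is NOT the continuum limit and NOT the Clay problem.»  THIS MODULE is [folklore] finite-window bookkeeping over leaf-06-g14's
`FP/NestedDressingKernel.piKSymNest` (FILE 4, p297167: field block windowed by `cube (d+1) (Lc^M)`, mixed blocks `0`, multiplier block the identity) and this lineage's
`FP/PerfectGaugeDefectBottomLimit.perfectDefectBottom_window_eq_zero_holds` (p297974).  No `def`, no `def … : Prop`, nothing cited, nothing of Bałaban's asserted,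
0 sorry; 0 estimates.  0∕4 row-D1 binders; NOT the finite-`j` Π-kill (SPLIT (i-a), leaf-06), NOT SPLIT (ii)(iii), NOT `G_N = G₁ + G_c`, NOT (SDF), NOT D1, NOT `BetaPertH`,
NOT continuum, NOT Clay.  «not in print; our bookkeeping».

ABSOLUTE RULE (cell charter, verbatim): «No internally-minted statement may enter as a cited fact. Every hypothesis is either kernel-proved in
this package or a verbatim quotation of a PUBLISHED theorem with page reference. The manuscript(s) under audit are NOT citable for their own
disputed steps — they are the thing under adjudication; programme-internal (2001/route/tribunal) claims are never citable.»

WHY.  Row SPLIT's dressed objects are `coDress_Π A := comp (comp (trK Π) A) Π` with `Π := piKSymNest (ctr) Lc (m+1)` (an2's kernel convention: `Π` represents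
`Π̂ᵀ`, so `comp (comp (trK Π) A) Π` is `Π̂·A·Π̂ᵀ` in operator convention, as glossed at `SymmetrisedDressingKernel.coDressKSymAt`); (i) says `[coDress_Π E♭_m]_ff = 0`.  `PerfectGaugeDefectBottomLimit` §3 proved the Π-AGNOSTIC form over arbitrary finite windows; THIS FILE instantiates the
window at leaf-06's kernel — its field block IS windowed (`piKSymNest_inl_inl`), its mixed blocks vanish (`piKSymNest_inl_inr ∕ _inr_inl`) — so the `ff` entry of the
co-dressing of ANY kernel `E` is a finite double-window sum of `E`'s `ff` entries (no summability needed), and the perfect-object statement follows from the finite-`j`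
one by `exact`.  What leaf-06's (i-a) now has to supply is LITERALLY `∀ᶠ j, [coDress_Π E_j^{bare}]_ff (x,z;a,b) = 0`.

CONTENT (`Π := piKSymNest ρ Lc M`, any root `ρ`, any `M`; `d` generic in §1–§2, `d + 1 = 4` in §3).
* §1 [folklore] `sum_piKSymNest_col_inl`, `sum_piKSymNest_row_inl` — the one-leg contractions against the windowed field block.
* §2 [folklore] **`coDressNest_ff_apply`** — for EVERY kernel `E`:
  `comp (comp (trK Π) E) Π x z (inl a) (inl b) = Σ_{v ∈ cube} Σ_κ Σ_{w ∈ cube} Σ_l pmSymNest ρ Lc M a x κ (x − v) · E (x − v) (z − w) (inl κ) (inl l) · pmSymNest ρ Lc M b z l (z − w)`.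
* §2 also: **`dressNestLeft_apply`** — a field row of the ONE-sided dressing `comp (trK Π) K` of any `K` is a finite window sum.
* §3 [our proof] **`coDressNest_perfectDefectBottom_ff_eq_zero_holds`** (`d + 1 = 4`, `Lc ≥ 2`, `m ≥ 1`):
  `(∀ᶠ j, [coDress_Π (KTot_{(j,1+m)} − (KTot_{(j,1)} − ((Lc^j)^5)²•KTot_{(j,1)}∘liftW Lc true true KTot_{(j+1,m)}∘KTot_{(j,1)}))]_ff (x,z;a,b) = 0)`
  `→ [coDress_Π (KPerf (m+1) − (KPerf 1 − (Lc·Lc)⁻¹•KPerf 1∘liftW Lc true true (KPerf m)∘KPerf 1))]_ff (x,z;a,b) = 0`.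
* §4 [folklore] **`dressNestLeft_apply_eq_of_tendsto`** (generic) and [our proof] **`dressNestLeft_KPerf_one_eq_holds`** (`d + 1 = 4`, `Lc ≥ 2`) — THE LIMIT HALF OF
  SPLIT (ii): two nested left dressings that agree on a field row of `U_j KTot_{(j,1)}` for all large `j` agree on that row of `KPerf … 1` (unconditional);
  two-sided twins **`coDressNest_ff_apply_eq_of_tendsto`** ∕ **`coDressNest_KPerf_one_ff_eq_holds`** (`[coDress_Π (KPerf 1)]_ff` from the finite-`j` co-dressings).
Unit `b2b-balaban-gan24-formalise-leaf-05` (gen 45), road «FP» row SPLIT (i-b) (+ the limit half of (ii)), sequel of `PerfectGaugeDefectBottomLimit`.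
-/

noncomputable section

namespace Summit.QuantumFields.BalabanUV.Beta.FP.PerfectGaugeDefectBottomDressed

open Finset Filter Topology
open scoped BigOperators
open Literature.MathematicalPhysics.QuantumFieldTheory.Balaban1983to89
open Literature.MathematicalPhysics.QuantumFieldTheory.Balaban1983to89.Beta
open ExpKernelCalculus (MKer comp)
open OneStepResolventKernel (Fib)
open InterLevelTransport (liftW)
open Summit.QuantumFields.BalabanUV.Beta.TameKernelCalculus (trK trK_apply)
open Summit.QuantumFields.BalabanUV.Beta.AxialDressingRooted (cube tsum_window')
open Summit.QuantumFields.BalabanUV.Beta.HessKerDressedUnits (unitK)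
open Summit.QuantumFields.BalabanUV.Beta.GAN24.CombesThomas (sfStep smStep)
open Summit.QuantumFields.BalabanUV.Beta.GAN24.RealRateKMHolds (tendsto_KTot_KPerf_holds)
open Summit.QuantumFields.BalabanUV.Beta.FP.PerfectObjects (KTot)
open Summit.QuantumFields.BalabanUV.Beta.FP.PerfectObjectsT (KPerf)
open Summit.QuantumFields.BalabanUV.Beta.FP.NestedDressingKernel (pmSymNest piKSymNest piKSymNest_inl_inl piKSymNest_inl_inr piKSymNest_inr_inl)
open Summit.QuantumFields.BalabanUV.Beta.FP.PerfectGaugeDefectBottomLimit (perfectDefectBottom_window_eq_zero_holds)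

section Window

variable {d : ℕ} (ρ : Fin (d + 1) → ℤ) (Lc M : ℕ)

/-! ## §0 A finite re-ordering -/

/-- [folklore] Re-ordering a finite double-window sum: `Σ_w Σ_l (Σ_v Σ_κ f) · Q = Σ_v Σ_κ Σ_w Σ_l f · Q`. -/
theorem window_reorder {α β : Type*} [Fintype β] (S T : Finset α) (f : α → β → α → β → ℝ) (Q : α → β → ℝ) :
    ∑ w ∈ T, ∑ l : β, (∑ v ∈ S, ∑ κ : β, f v κ w l) * Q w l = ∑ v ∈ S, ∑ κ : β, ∑ w ∈ T, ∑ l : β, f v κ w l * Q w l := by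
  have h1 : ∀ w ∈ T, ∑ l : β, (∑ v ∈ S, ∑ κ : β, f v κ w l) * Q w l = ∑ v ∈ S, ∑ κ : β, ∑ l : β, f v κ w l * Q w l := by
    intro w _
    calc ∑ l : β, (∑ v ∈ S, ∑ κ : β, f v κ w l) * Q w l
        = ∑ l : β, ∑ v ∈ S, ∑ κ : β, f v κ w l * Q w l := by
          refine Finset.sum_congr rfl fun l _ => ?_
          rw [Finset.sum_mul]
          refine Finset.sum_congr rfl fun v _ => ?_
          rw [Finset.sum_mul]
      _ = ∑ v ∈ S, ∑ l : β, ∑ κ : β, f v κ w l * Q w l := Finset.sum_comm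
      _ = ∑ v ∈ S, ∑ κ : β, ∑ l : β, f v κ w l * Q w l := by
          refine Finset.sum_congr rfl fun v _ => ?_
          exact Finset.sum_comm
  rw [Finset.sum_congr rfl h1, Finset.sum_comm]
  refine Finset.sum_congr rfl fun v _ => ?_
  rw [Finset.sum_comm]

/-! ## §1 One-leg contractions against the windowed field block -/

/-- [folklore] Contracting the FIRST leg of `Π` into a field column: only field legs inside the window survive. -/
theorem sum_piKSymNest_col_inl (u u' : Fin (d + 1) → ℤ) (a : Fin (d + 1)) (g : Fib d → ℝ) :
    ∑ f : Fib d, piKSymNest ρ Lc M u u' f (Sum.inl a) * g f =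
      if u' - u ∈ cube (d + 1) (Lc ^ M) then ∑ κ : Fin (d + 1), pmSymNest ρ Lc M a u' κ u * g (Sum.inl κ) else 0 := by
  rw [Fintype.sum_sum_type]
  simp only [piKSymNest_inl_inl, piKSymNest_inr_inl, zero_mul, Finset.sum_const_zero, add_zero]
  split_ifs
  · rfl
  · simp

/-- [folklore] Contracting the SECOND leg of `Π` out of a field row: only field legs inside the window survive. -/
theorem sum_piKSymNest_row_inl (y z : Fin (d + 1) → ℤ) (b : Fin (d + 1)) (g : Fib d → ℝ) :
    ∑ f : Fib d, g f * piKSymNest ρ Lc M y z f (Sum.inl b) =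
      if z - y ∈ cube (d + 1) (Lc ^ M) then ∑ l : Fin (d + 1), g (Sum.inl l) * pmSymNest ρ Lc M b z l y else 0 := by
  rw [Fintype.sum_sum_type]
  simp only [piKSymNest_inl_inl, piKSymNest_inr_inl, mul_zero, Finset.sum_const_zero, add_zero]
  split_ifs
  · rfl
  · simp

/-! ## §2 One-sided and two-sided dressings of any kernel are finite window sums on field rows -/

/-- [folklore] **A FIELD ROW OF THE LEFT DRESSING `Π̂·K` (cell convention `comp (trK Π) K`, `Π := piKSymNest ρ Lc M`) OF ANY KERNEL `K`** is a finite window sum: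
`comp (trK Π) K x y′ (inl a) f′ = Σ_{v ∈ cube (Lc^M)} Σ_κ pmSymNest ρ Lc M a x κ (x − v) · K (x − v) y′ (inl κ) f′` — no summability hypothesis. -/
theorem dressNestLeft_apply (K : MKer (d + 1) (Fib d)) (x y' : Fin (d + 1) → ℤ) (a : Fin (d + 1)) (f' : Fib d) :
    comp (trK (piKSymNest ρ Lc M)) K x y' (Sum.inl a) f'
      = ∑ v ∈ cube (d + 1) (Lc ^ M), ∑ κ : Fin (d + 1), pmSymNest ρ Lc M a x κ (x - v) * K (x - v) y' (Sum.inl κ) f' := by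
  unfold ExpKernelCalculus.comp
  simp only [trK_apply]
  have h : ∀ y, ∑ f : Fib d, piKSymNest ρ Lc M y x f (Sum.inl a) * K y y' f f'
      = if x - y ∈ cube (d + 1) (Lc ^ M) then ∑ κ : Fin (d + 1), pmSymNest ρ Lc M a x κ y * K y y' (Sum.inl κ) f' else 0 :=
    fun y => sum_piKSymNest_col_inl ρ Lc M y x a (fun f => K y y' f f')
  simp_rw [h]
  rw [tsum_window']

/-- [folklore] **THE `ff` ENTRY OF `Π̂·E·Π̂ᵀ` (cell convention `comp (comp (trK Π) E) Π`, `Π := piKSymNest ρ Lc M`) FOR EVERY KERNEL `E`**: a finite sum over the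
two windows `x − cube`, `z − cube` of `E`'s field–field entries weighted by the projector matrix — no summability hypothesis. -/
theorem coDressNest_ff_apply (E : MKer (d + 1) (Fib d)) (x z : Fin (d + 1) → ℤ) (a b : Fin (d + 1)) :
    comp (comp (trK (piKSymNest ρ Lc M)) E) (piKSymNest ρ Lc M) x z (Sum.inl a) (Sum.inl b)
      = ∑ v ∈ cube (d + 1) (Lc ^ M), ∑ κ : Fin (d + 1), ∑ w ∈ cube (d + 1) (Lc ^ M), ∑ l : Fin (d + 1),
          pmSymNest ρ Lc M a x κ (x - v) * E (x - v) (z - w) (Sum.inl κ) (Sum.inl l) * pmSymNest ρ Lc M b z l (z - w) := by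
  -- the inner composition `(Πᵀ E) x y' (inl a) f'` is the window sum `dressNestLeft_apply`
  have inner : ∀ (y' : Fin (d + 1) → ℤ) (f' : Fib d),
      comp (trK (piKSymNest ρ Lc M)) E x y' (Sum.inl a) f'
        = ∑ v ∈ cube (d + 1) (Lc ^ M), ∑ κ : Fin (d + 1), pmSymNest ρ Lc M a x κ (x - v) * E (x - v) y' (Sum.inl κ) f' :=
    fun y' f' => dressNestLeft_apply ρ Lc M E x y' a f'
  unfold ExpKernelCalculus.comp
  have h2 : ∀ y', ∑ f' : Fib d, (∑' y, ∑ f : Fib d, trK (piKSymNest ρ Lc M) x y (Sum.inl a) f * E y y' f f') * piKSymNest ρ Lc M y' z f' (Sum.inl b)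
      = if z - y' ∈ cube (d + 1) (Lc ^ M) then
          ∑ l : Fin (d + 1), (∑ v ∈ cube (d + 1) (Lc ^ M), ∑ κ : Fin (d + 1), pmSymNest ρ Lc M a x κ (x - v) * E (x - v) y' (Sum.inl κ) (Sum.inl l))
            * pmSymNest ρ Lc M b z l y' else 0 := by
    intro y'
    have h3 : ∀ f' : Fib d, (∑' y, ∑ f : Fib d, trK (piKSymNest ρ Lc M) x y (Sum.inl a) f * E y y' f f')
        = comp (trK (piKSymNest ρ Lc M)) E x y' (Sum.inl a) f' := fun f' => rfl
    simp_rw [h3, sum_piKSymNest_row_inl ρ Lc M y' z b (fun f' => comp (trK (piKSymNest ρ Lc M)) E x y' (Sum.inl a) f'), inner]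
  simp_rw [h2]
  rw [tsum_window']
  -- reorder the finite sums
  exact window_reorder (cube (d + 1) (Lc ^ M)) (cube (d + 1) (Lc ^ M))
    (fun v κ w l => pmSymNest ρ Lc M a x κ (x - v) * E (x - v) (z - w) (Sum.inl κ) (Sum.inl l)) (fun w l => pmSymNest ρ Lc M b z l (z - w))

end Window

/-! ## §3 SPLIT (i-b) in Π-currency: the perfect-object statement from the finite-`j` one -/

section Perfect

variable (Lc : ℕ) [NeZero Lc]

/-- [our proof] **`[Π̂·E♭_m·Π̂ᵀ]_ff = 0 ⟸ [Π̂·E_j^{bare}·Π̂ᵀ]_ff = 0` AT (EVENTUALLY) EVERY FINITE `j`** (`d + 1 = 4`, `Lc ≥ 2`, `m ≥ 1`; `Π := piKSymNest ρ Lc M`, any `ρ`, `M`;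
the defects as KERNELS, pointwise `−` and `•` on `MKer`): `coDressNest_ff_apply` on both sides + `PerfectGaugeDefectBottomLimit.perfectDefectBottom_window_eq_zero_holds`
with the windows `S := (cube).image (x − ·)`, `T := (cube).image (z − ·)` and the projector matrix rows∕columns as coefficients. -/
theorem coDressNest_perfectDefectBottom_ff_eq_zero_holds (hLc : 2 ≤ Lc) {m : ℕ} (hm : 1 ≤ m) (ρ : Fin (3 + 1) → ℤ) (M : ℕ)
    (x z : Fin (3 + 1) → ℤ) (a b : Fin (3 + 1))
    (h0 : ∀ᶠ j in atTop,
      comp (comp (trK (piKSymNest ρ Lc M))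
          (KTot (d := 3) (Lc ^ (j + 1 + m)) (Lc ^ j)
            - (KTot (d := 3) (Lc ^ (j + 1)) (Lc ^ j)
              - ((((Lc ^ j : ℕ) : ℝ)) ^ (3 + 2) * (((Lc ^ j : ℕ) : ℝ)) ^ (3 + 2))
                • comp (KTot (d := 3) (Lc ^ (j + 1)) (Lc ^ j))
                    (comp (liftW Lc true true (KTot (d := 3) (Lc ^ (j + 1 + m)) (Lc ^ (j + 1)))) (KTot (d := 3) (Lc ^ (j + 1)) (Lc ^ j))))))
        (piKSymNest ρ Lc M) x z (Sum.inl a) (Sum.inl b) = 0) :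
    comp (comp (trK (piKSymNest ρ Lc M))
        (KPerf (d := 3) Lc (sfStep Lc) (smStep 3 Lc) (m + 1)
          - (KPerf (d := 3) Lc (sfStep Lc) (smStep 3 Lc) 1
            - (((Lc : ℝ)) * ((Lc : ℝ)))⁻¹
              • comp (KPerf (d := 3) Lc (sfStep Lc) (smStep 3 Lc) 1)
                  (comp (liftW Lc true true (KPerf (d := 3) Lc (sfStep Lc) (smStep 3 Lc) m)) (KPerf (d := 3) Lc (sfStep Lc) (smStep 3 Lc) 1)))))
      (piKSymNest ρ Lc M) x z (Sum.inl a) (Sum.inl b) = 0 := by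
  classical
  rw [coDressNest_ff_apply]
  simp only [Pi.sub_apply, Pi.smul_apply, smul_eq_mul]
  -- re-index the windows by sites
  have hinjx : Set.InjOn (fun v : Fin (3 + 1) → ℤ => x - v) ↑(cube (3 + 1) (Lc ^ M)) := fun v _ w _ hvw => sub_right_injective hvw
  have hinjz : Set.InjOn (fun w : Fin (3 + 1) → ℤ => z - w) ↑(cube (3 + 1) (Lc ^ M)) := fun v _ w _ hvw => sub_right_injective hvw
  have key := perfectDefectBottom_window_eq_zero_holds Lc hLc hm ((cube (3 + 1) (Lc ^ M)).image fun v => x - v)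
    ((cube (3 + 1) (Lc ^ M)).image fun w => z - w) (fun y κ => pmSymNest ρ Lc M a x κ y) (fun y' l => pmSymNest ρ Lc M b z l y') ?_
  · rw [Finset.sum_image hinjx] at key
    simp_rw [Finset.sum_image hinjz] at key
    exact key
  · filter_upwards [h0] with j hj
    rw [coDressNest_ff_apply] at hj
    simp only [Pi.sub_apply, Pi.smul_apply, smul_eq_mul] at hj
    rw [Finset.sum_image hinjx]
    simp_rw [Finset.sum_image hinjz]
    exact hj

/-! ## §4 Entrywise limits pass through the one-sided window: the limit half of SPLIT (ii) -/

omit [NeZero Lc] in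
/-- [folklore] **TWO LEFT DRESSINGS THAT AGREE ON A FIELD ROW OF AN ENTRYWISE-CONVERGENT FAMILY AGREE ON ITS LIMIT** (generic `d`; projectors
`piKSymNest ρ Lc M`, `piKSymNest ρ′ Lc′ M′`; leg `a` resp. `a′`): finite window sums of limits. -/
theorem dressNestLeft_apply_eq_of_tendsto {d : ℕ} (ρ ρ' : Fin (d + 1) → ℤ) (Lc' M M' : ℕ) {K : ℕ → MKer (d + 1) (Fib d)} {Kinf : MKer (d + 1) (Fib d)}
    (hK : ∀ x y a b, Tendsto (fun j => K j x y a b) atTop (𝓝 (Kinf x y a b))) (x y' : Fin (d + 1) → ℤ) (a a' : Fin (d + 1)) (f' : Fib d)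
    (h : ∀ᶠ j in atTop, comp (trK (piKSymNest ρ Lc M)) (K j) x y' (Sum.inl a) f' = comp (trK (piKSymNest ρ' Lc' M')) (K j) x y' (Sum.inl a') f') :
    comp (trK (piKSymNest ρ Lc M)) Kinf x y' (Sum.inl a) f' = comp (trK (piKSymNest ρ' Lc' M')) Kinf x y' (Sum.inl a') f' := by
  simp only [dressNestLeft_apply] at h ⊢
  have l1 : Tendsto (fun j => ∑ v ∈ cube (d + 1) (Lc ^ M), ∑ κ : Fin (d + 1), pmSymNest ρ Lc M a x κ (x - v) * K j (x - v) y' (Sum.inl κ) f') atTop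
      (𝓝 (∑ v ∈ cube (d + 1) (Lc ^ M), ∑ κ : Fin (d + 1), pmSymNest ρ Lc M a x κ (x - v) * Kinf (x - v) y' (Sum.inl κ) f')) :=
    tendsto_finsetSum _ fun v _ => tendsto_finsetSum _ fun κ _ => (hK _ _ _ _).const_mul _
  have l2 : Tendsto (fun j => ∑ v ∈ cube (d + 1) (Lc' ^ M'), ∑ κ : Fin (d + 1), pmSymNest ρ' Lc' M' a' x κ (x - v) * K j (x - v) y' (Sum.inl κ) f') atTop
      (𝓝 (∑ v ∈ cube (d + 1) (Lc' ^ M'), ∑ κ : Fin (d + 1), pmSymNest ρ' Lc' M' a' x κ (x - v) * Kinf (x - v) y' (Sum.inl κ) f')) :=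
    tendsto_finsetSum _ fun v _ => tendsto_finsetSum _ fun κ _ => (hK _ _ _ _).const_mul _
  exact tendsto_nhds_unique (l1.congr' h) l2

/-- [our proof] **THE LIMIT HALF OF SPLIT (ii)** (`d + 1 = 4`, `Lc ≥ 2`; UNCONDITIONAL by `RealRateKMHolds.tendsto_KTot_KPerf_holds` at `m = 1`): if two nested-projector left
dressings agree on a field row of the unit-rescaled one-step resolvents `U_j KTot_{(j,1)}` for all large `j` (e.g. `Π^{(m+1)}` and `Π^{(1)} = piKSymBm` by (N-fine) at
finite `j` — leaf-06's part), they agree on the same row of the PERFECT one-step resolvent `KPerf … 1`. -/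
theorem dressNestLeft_KPerf_one_eq_holds (hLc : 2 ≤ Lc) (ρ ρ' : Fin (3 + 1) → ℤ) (M M' : ℕ) (x y' : Fin (3 + 1) → ℤ) (a a' : Fin (3 + 1)) (f' : Fib 3)
    (h : ∀ᶠ j in atTop,
      comp (trK (piKSymNest ρ Lc M)) (unitK (sfStep Lc j) (smStep 3 Lc j) (KTot (d := 3) (Lc ^ (j + 1)) (Lc ^ j))) x y' (Sum.inl a) f'
        = comp (trK (piKSymNest ρ' Lc M')) (unitK (sfStep Lc j) (smStep 3 Lc j) (KTot (d := 3) (Lc ^ (j + 1)) (Lc ^ j))) x y' (Sum.inl a') f') :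
    comp (trK (piKSymNest ρ Lc M)) (KPerf (d := 3) Lc (sfStep Lc) (smStep 3 Lc) 1) x y' (Sum.inl a) f'
      = comp (trK (piKSymNest ρ' Lc M')) (KPerf (d := 3) Lc (sfStep Lc) (smStep 3 Lc) 1) x y' (Sum.inl a') f' :=
  dressNestLeft_apply_eq_of_tendsto Lc ρ ρ' Lc M M' (fun x y a b => tendsto_KTot_KPerf_holds hLc (m := 1) le_rfl x y a b) x y' a a' f' h

omit [NeZero Lc] in
/-- [folklore] **TWO CO-DRESSINGS THAT AGREE ON THE `ff` ENTRY OF AN ENTRYWISE-CONVERGENT FAMILY AGREE ON ITS LIMIT** (generic `d`; two-sided twin of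
`dressNestLeft_apply_eq_of_tendsto`): finite double-window sums of limits. -/
theorem coDressNest_ff_apply_eq_of_tendsto {d : ℕ} (ρ ρ' : Fin (d + 1) → ℤ) (Lc' M M' : ℕ) {K : ℕ → MKer (d + 1) (Fib d)} {Kinf : MKer (d + 1) (Fib d)}
    (hK : ∀ x y a b, Tendsto (fun j => K j x y a b) atTop (𝓝 (Kinf x y a b))) (x z : Fin (d + 1) → ℤ) (a b a' b' : Fin (d + 1))
    (h : ∀ᶠ j in atTop, comp (comp (trK (piKSymNest ρ Lc M)) (K j)) (piKSymNest ρ Lc M) x z (Sum.inl a) (Sum.inl b)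
      = comp (comp (trK (piKSymNest ρ' Lc' M')) (K j)) (piKSymNest ρ' Lc' M') x z (Sum.inl a') (Sum.inl b')) :
    comp (comp (trK (piKSymNest ρ Lc M)) Kinf) (piKSymNest ρ Lc M) x z (Sum.inl a) (Sum.inl b)
      = comp (comp (trK (piKSymNest ρ' Lc' M')) Kinf) (piKSymNest ρ' Lc' M') x z (Sum.inl a') (Sum.inl b') := by
  simp only [coDressNest_ff_apply] at h ⊢
  have l1 : Tendsto (fun j => ∑ v ∈ cube (d + 1) (Lc ^ M), ∑ κ : Fin (d + 1), ∑ w ∈ cube (d + 1) (Lc ^ M), ∑ l : Fin (d + 1),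
        pmSymNest ρ Lc M a x κ (x - v) * K j (x - v) (z - w) (Sum.inl κ) (Sum.inl l) * pmSymNest ρ Lc M b z l (z - w)) atTop
      (𝓝 (∑ v ∈ cube (d + 1) (Lc ^ M), ∑ κ : Fin (d + 1), ∑ w ∈ cube (d + 1) (Lc ^ M), ∑ l : Fin (d + 1),
        pmSymNest ρ Lc M a x κ (x - v) * Kinf (x - v) (z - w) (Sum.inl κ) (Sum.inl l) * pmSymNest ρ Lc M b z l (z - w))) :=
    tendsto_finsetSum _ fun v _ => tendsto_finsetSum _ fun κ _ => tendsto_finsetSum _ fun w _ => tendsto_finsetSum _ fun l _ =>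
      ((hK _ _ _ _).const_mul _).mul_const _
  have l2 : Tendsto (fun j => ∑ v ∈ cube (d + 1) (Lc' ^ M'), ∑ κ : Fin (d + 1), ∑ w ∈ cube (d + 1) (Lc' ^ M'), ∑ l : Fin (d + 1),
        pmSymNest ρ' Lc' M' a' x κ (x - v) * K j (x - v) (z - w) (Sum.inl κ) (Sum.inl l) * pmSymNest ρ' Lc' M' b' z l (z - w)) atTop
      (𝓝 (∑ v ∈ cube (d + 1) (Lc' ^ M'), ∑ κ : Fin (d + 1), ∑ w ∈ cube (d + 1) (Lc' ^ M'), ∑ l : Fin (d + 1),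
        pmSymNest ρ' Lc' M' a' x κ (x - v) * Kinf (x - v) (z - w) (Sum.inl κ) (Sum.inl l) * pmSymNest ρ' Lc' M' b' z l (z - w))) :=
    tendsto_finsetSum _ fun v _ => tendsto_finsetSum _ fun κ _ => tendsto_finsetSum _ fun w _ => tendsto_finsetSum _ fun l _ =>
      ((hK _ _ _ _).const_mul _).mul_const _
  exact tendsto_nhds_unique (l1.congr' h) l2

/-- [our proof] **THE LIMIT HALF OF SPLIT (ii), TWO-SIDED** (`d + 1 = 4`, `Lc ≥ 2`; UNCONDITIONAL): if the co-dressings by `piKSymNest ρ Lc M` and `piKSymNest ρ′ Lc M′`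
of the unit-rescaled one-step resolvents `U_j KTot_{(j,1)}` have the same `ff` entry for all large `j`, so do the co-dressings of `KPerf … 1` — e.g. `M := m + 1`,
`M′ := 1` (`piKSymNest ρ Lc 1 = piKSymBm ρ Lc`, FILE 4 `piKSymNest_one`): `[coDress_{Π^{(m+1)}} (KPerf 1)]_ff = [coDress_{Π̂₁} (KPerf 1)]_ff = [G₁]_ff` from leaf-06's
finite-`j` (N-fine) identity. -/
theorem coDressNest_KPerf_one_ff_eq_holds (hLc : 2 ≤ Lc) (ρ ρ' : Fin (3 + 1) → ℤ) (M M' : ℕ) (x z : Fin (3 + 1) → ℤ) (a b a' b' : Fin (3 + 1))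
    (h : ∀ᶠ j in atTop,
      comp (comp (trK (piKSymNest ρ Lc M)) (unitK (sfStep Lc j) (smStep 3 Lc j) (KTot (d := 3) (Lc ^ (j + 1)) (Lc ^ j)))) (piKSymNest ρ Lc M)
          x z (Sum.inl a) (Sum.inl b)
        = comp (comp (trK (piKSymNest ρ' Lc M')) (unitK (sfStep Lc j) (smStep 3 Lc j) (KTot (d := 3) (Lc ^ (j + 1)) (Lc ^ j)))) (piKSymNest ρ' Lc M')
          x z (Sum.inl a') (Sum.inl b')) :
    comp (comp (trK (piKSymNest ρ Lc M)) (KPerf (d := 3) Lc (sfStep Lc) (smStep 3 Lc) 1)) (piKSymNest ρ Lc M) x z (Sum.inl a) (Sum.inl b)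
      = comp (comp (trK (piKSymNest ρ' Lc M')) (KPerf (d := 3) Lc (sfStep Lc) (smStep 3 Lc) 1)) (piKSymNest ρ' Lc M') x z (Sum.inl a') (Sum.inl b') :=
  coDressNest_ff_apply_eq_of_tendsto Lc ρ ρ' Lc M M' (fun x y a b => tendsto_KTot_KPerf_holds hLc (m := 1) le_rfl x y a b) x z a b a' b' h

end Perfect

end Summit.QuantumFields.BalabanUV.Beta.FP.PerfectGaugeDefectBottomDressed

end
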